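import Mathlib.Analysis.SpecialFunctions.Pow.Real
import Mathlib.Analysis.SpecialFunctions.Exp
import Mathlib.Analysis.Complex.ExponentialBounds
import Literature.Computability.MetaComplexity.SumOfSquares
import Literature.Computability.MetaComplexity.ScopeExpansion
import Literature.Computability.MetaComplexity.RandomScopes
import Literature.Computability.MetaComplexity.ScopeExpansionProofs
import Literature.Computability.MetaComplexity.XorPseudoexpectation
import HarnessLib

/-!
# The KMOW lower bound for random `k`-SAT: assembly

Trunk Literature/Computability/MetaComplexity. We derive the named fact `kmow_sos_random_kSAT`
(`SumOfSquares.lean`; Kothari–Mori–O'Donnell–Witmer 2017, Thm. 7.1 for `P = OR_k`) from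

* the random-graph theorem `kmow_random_kCNF_plausible` (KMOW Thm. 4.12, `ScopeExpansion.lean`;
  discharged in `ScopeExpansionProofs.lean`), and
* the deterministic Grigoriev–Schoenebeck theorem `sosFailsToRefute_of_isBoundaryExpander`
  (`XorPseudoexpectation.lean`, proved),

following KMOW §7: price `ζ = 1/log Δ`, `SMALL = ⌊γ n / Δ^{2/(k-2-ζ)}⌋`, cover expansion
`(k+ζ)/2` ⇒ boundary expansion `ζ` ⇒ degree `ζ·SMALL ≥ β^{3C₀/k}/(k 2^{4C₀+7}) · n/(Δ^{2/(k-2)} log Δ)`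
for large `n` (the universal constants are `a = 3C₀`, `b = 4C₀ + 7` in terms of KMOW's exponent
`C₀` of Thm. 4.12; failure probability `β/2 < 1/2`).

## References

* P. K. Kothari, R. Mori, R. O'Donnell, D. Witmer, *Sum of squares lower bounds for refuting any
  CSP*, STOC 2017, arXiv:1701.04521, §7 (proof of Thm. 7.1 from Thm. 4.12 and Thm. 2.9/5.x).
* G. Schoenebeck, *Linear level Lasserre lower bounds for certain k-CSPs*, FOCS 2008, §5.
-/

noncomputable section

open Filter Finset Literature.Computability.Complexity
open scoped Topology

namespace Literature.Computability.MetaComplexity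

/-! ### Monotonicity of SOS failure in the degree -/

/-- A degree-`d` pseudoexpectation is a degree-`d'` one for `d' ≤ d`; so if degree `d` fails to
refute then so does every smaller degree. [Kothari–Mori–O'Donnell–Witmer 2017, §2.3] [folklore] -/
theorem SOSFailsToRefute.of_le {d d' : ℕ} {φ : CNF ℕ} (h : SOSFailsToRefute d φ) (hd : d' ≤ d) :
    SOSFailsToRefute d' φ := by
  obtain ⟨E, ⟨h1, h2⟩, h3, h4⟩ := h
  exact ⟨E, ⟨h1, fun p hp => h2 p (hp.trans hd)⟩, fun v r hr => h3 v r (hr.trans hd),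
    fun C hC r hr => h4 C hC r (hr.trans hd)⟩

/-! ### Clauses of the random ensemble have `k` distinct variables -/

/-- Clauses of `kClauses k n` have pairwise distinct variables. [Ben-Sasson–Wigderson 2001, §6]
[folklore] -/
theorem nodup_map_fst_of_mem_kClauses {k n : ℕ} {C : Clause ℕ} (h : C ∈ kClauses k n) :
    (C.map Prod.fst).Nodup := by
  obtain ⟨S, -, ε, rfl⟩ := exists_eq_clauseOf_of_mem_kClauses h
  rw [map_fst_clauseOf]
  exact (Finset.sort_nodup _ _).map Fin.val_injective

/-! ### Numerical constants -/

/-- `log 10 > 2`. [folklore] -/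
theorem two_lt_log_ten : (2 : ℝ) < Real.log 10 := by
  rw [Real.lt_log_iff_exp_lt (by norm_num)]
  have h := Real.exp_one_lt_d9
  have h0 := Real.exp_pos 1
  calc Real.exp 2 = Real.exp 1 * Real.exp 1 := by rw [← Real.exp_add]; norm_num
    _ < 2.7182818286 * 2.7182818286 := by gcongr
    _ < 10 := by norm_num

/-- `e⁴ < 64`. [folklore] -/
theorem exp_four_lt : Real.exp 4 < 64 := by
  have h := Real.exp_one_lt_d9
  have h0 := Real.exp_pos 1
  calc Real.exp 4 = Real.exp 1 ^ 4 := by rw [← Real.exp_one_rpow, ← Real.rpow_natCast]; norm_num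
    _ < 2.7182818286 ^ 4 := by gcongr
    _ < 64 := by norm_num

/-! ### The two constants of KMOW §7 -/

/-- `γ ≤ 1/k`: the base `β^{1/(k-2)}/2^{k/(k-2)}` of `kmowGamma` is `≤ 1`. [Kothari–Mori–O'Donnell–
Witmer 2017, Thm. 4.12] [folklore] -/
theorem kmowGamma_le {C₀ β : ℝ} {k : ℕ} (hC : 0 ≤ C₀) (hk : 3 ≤ k) (hβ0 : 0 < β) (hβ1 : β ≤ 1) :
    kmowGamma C₀ k β ≤ 1 / k := by
  have hk' : (3 : ℝ) ≤ k := by exact_mod_cast hk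
  unfold kmowGamma
  have hbase0 : 0 ≤ β ^ (1 / ((k : ℝ) - 2)) / 2 ^ ((k : ℝ) / ((k : ℝ) - 2)) := by positivity
  have hbase1 : β ^ (1 / ((k : ℝ) - 2)) / 2 ^ ((k : ℝ) / ((k : ℝ) - 2)) ≤ 1 := by
    rw [div_le_one (by positivity)]
    calc β ^ (1 / ((k : ℝ) - 2)) ≤ 1 := Real.rpow_le_one hβ0.le hβ1 (by
            have : (0:ℝ) < (k : ℝ) - 2 := by linarith
            positivity)
      _ ≤ 2 ^ ((k : ℝ) / ((k : ℝ) - 2)) := Real.one_le_rpow (by norm_num) (by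
            have : (0:ℝ) < (k : ℝ) - 2 := by linarith
            positivity)
  have : (β ^ (1 / ((k : ℝ) - 2)) / 2 ^ ((k : ℝ) / ((k : ℝ) - 2))) ^ C₀ ≤ 1 :=
    Real.rpow_le_one hbase0 hbase1 hC
  calc 1 / (k : ℝ) * (β ^ (1 / ((k : ℝ) - 2)) / 2 ^ ((k : ℝ) / ((k : ℝ) - 2))) ^ C₀
      ≤ 1 / (k : ℝ) * 1 := by gcongr
    _ = 1 / k := mul_one _

/-- `γ(β/2) ≥ β^{3C₀/k} 2^{-4C₀}/k` for `k ≥ 3`: the only place where the `k`-dependence of the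
exponents is used (`1/(k-2) ≤ 3/k`, `k/(k-2) ≤ 3`). [Kothari–Mori–O'Donnell–Witmer 2017, §7
("`γ = β^{O(1/λ)}/(K 2^{O(K/λ)})`")] [folklore] -/
theorem kmowGamma_half_ge {C₀ β : ℝ} {k : ℕ} (hC : 0 ≤ C₀) (hk : 3 ≤ k) (hβ0 : 0 < β) (hβ1 : β < 1) :
    1 / (k : ℝ) * (β ^ (3 * C₀ / k) * (2 : ℝ) ^ (-(4 * C₀))) ≤ kmowGamma C₀ k (β / 2) := by
  have hk' : (3 : ℝ) ≤ k := by exact_mod_cast hk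
  have hk2 : (0 : ℝ) < (k : ℝ) - 2 := by linarith
  have hkpos : (0 : ℝ) < k := by linarith
  unfold kmowGamma
  gcongr
  rw [Real.div_rpow (by positivity) (by positivity), ← Real.rpow_mul (by positivity),
    ← Real.rpow_mul (by norm_num)]
  -- (β/2)^{C₀/(k-2)} / 2^{k C₀/(k-2)} ≥ β^{3C₀/k} 2^{-4C₀}
  have e1 : 1 / ((k : ℝ) - 2) * C₀ ≤ 3 * C₀ / k := by
    rw [div_mul_eq_mul_div, one_mul, div_le_div_iff₀ hk2 hkpos]
    nlinarith
  have e2 : (k : ℝ) / ((k : ℝ) - 2) * C₀ ≤ 3 * C₀ := by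
    have : (k : ℝ) / ((k : ℝ) - 2) ≤ 3 := by rw [div_le_iff₀ hk2]; linarith
    nlinarith
  have h1 : (β / 2) ^ (3 * C₀ / k) ≤ (β / 2) ^ (1 / ((k : ℝ) - 2) * C₀) :=
    Real.rpow_le_rpow_of_exponent_ge (by positivity) (by linarith) e1
  have h2 : (2 : ℝ) ^ ((k : ℝ) / ((k : ℝ) - 2) * C₀) ≤ 2 ^ (3 * C₀) :=
    Real.rpow_le_rpow_of_exponent_le (by norm_num) e2
  have h3 : (β / 2) ^ (3 * C₀ / k) = β ^ (3 * C₀ / k) / 2 ^ (3 * C₀ / k) :=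
    Real.div_rpow hβ0.le (by norm_num) _
  have h4 : (2 : ℝ) ^ (3 * C₀ / k) ≤ 2 ^ C₀ :=
    Real.rpow_le_rpow_of_exponent_le (by norm_num) (by
      rw [div_le_iff₀ hkpos]; nlinarith)
  have h5 : (2 : ℝ) ^ (-(4 * C₀)) = 1 / (2 ^ C₀ * 2 ^ (3 * C₀)) := by
    rw [Real.rpow_neg (by norm_num), ← Real.rpow_add (by norm_num), one_div]
    ring_nf
  rw [h5]
  calc β ^ (3 * C₀ / ↑k) * (1 / (2 ^ C₀ * 2 ^ (3 * C₀)))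
      = (β ^ (3 * C₀ / ↑k) / 2 ^ C₀) / 2 ^ (3 * C₀) := by ring
    _ ≤ (β ^ (3 * C₀ / ↑k) / 2 ^ (3 * C₀ / k)) / 2 ^ ((k : ℝ) / ((k : ℝ) - 2) * C₀) := by
        gcongr
    _ = (β / 2) ^ (3 * C₀ / k) / 2 ^ ((k : ℝ) / ((k : ℝ) - 2) * C₀) := by rw [h3]
    _ ≤ (β / 2) ^ (1 / ((k : ℝ) - 2) * C₀) / 2 ^ ((k : ℝ) / ((k : ℝ) - 2) * C₀) := by gcongr

/-- The price of the price: `Δ^{2/(k-2-ζ)} ≤ e⁴ Δ^{2/(k-2)}` for `ζ = 1/log Δ`, `Δ ≥ 10`, `k ≥ 3`.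
[Kothari–Mori–O'Donnell–Witmer 2017, §7 (choice `ζ = 1/log Δ`)] [folklore] -/
theorem rpow_price_le {Δ : ℝ} {k : ℕ} (hΔ : 10 ≤ Δ) (hk : 3 ≤ k) :
    Δ ^ (2 / ((k : ℝ) - 2 - 1 / Real.log Δ)) ≤ Real.exp 4 * Δ ^ (2 / ((k : ℝ) - 2)) := by
  have hk' : (3 : ℝ) ≤ k := by exact_mod_cast hk
  have hΔpos : 0 < Δ := by linarith
  have hΔ1 : 1 ≤ Δ := by linarith
  set L := Real.log Δ with hL
  have hL2 : 2 < L := two_lt_log_ten.trans_le (Real.log_le_log (by norm_num) hΔ)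
  have hLpos : 0 < L := by linarith
  set m := (k : ℝ) - 2 with hm
  have hm1 : 1 ≤ m := by linarith
  set ζ := 1 / L with hζ
  have hζpos : 0 < ζ := by positivity
  have hζhalf : ζ < 1 / 2 := by
    rw [hζ, one_div_lt_one_div hLpos (by norm_num)]; exact hL2
  have hmζ : 1 / 2 ≤ m - ζ := by linarith
  have hprod : 1 / 2 ≤ (m - ζ) * m := by nlinarith
  have hdiff : 2 / (m - ζ) - 2 / m ≤ 4 * ζ := by
    rw [div_sub_div _ _ (by linarith) (by linarith), div_le_iff₀ (by positivity)]
    nlinarith [mul_le_mul_of_nonneg_left hprod (by positivity : (0:ℝ) ≤ 4 * ζ)]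
  have hsplit : Δ ^ (2 / (m - ζ)) = Δ ^ (2 / m) * Δ ^ (2 / (m - ζ) - 2 / m) := by
    rw [← Real.rpow_add hΔpos]; ring_nf
  rw [hsplit, mul_comm]
  gcongr
  calc Δ ^ (2 / (m - ζ) - 2 / m) ≤ Δ ^ (4 * ζ) := Real.rpow_le_rpow_of_exponent_le hΔ1 hdiff
    _ = Real.exp 4 := by
        rw [Real.rpow_def_of_pos hΔpos, hζ, hL]
        congr 1
        have : Real.log Δ ≠ 0 := by rw [← hL]; exact hLpos.ne'
        field_simp

/-! ### The assembly -/

/-- **KMOW Thm. 7.1 for `k`-SAT from the random-graph theorem.** Given KMOW's Thm. 4.12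
(`kmow_random_kCNF_plausible`, with universal exponent `C₀`), the named fact
`kmow_sos_random_kSAT` holds with `a = 3 C₀`, `b = 4 C₀ + 7`: set `ζ = 1/log Δ`, apply Thm. 4.12
with failure probability `β/2` and `SMALL = ⌊γ n / Δ^{2/(k-2-ζ)}⌋`, pass from cover expansion
`(k+ζ)/2` to boundary expansion `ζ` (`IsCoverExpander.isBoundaryExpander`; the clauses of the
ensemble have `k` distinct variables), and invoke the Grigoriev–Schoenebeck theorem
`sosFailsToRefute_of_isBoundaryExpander` in degree `⌊ζ · SMALL⌋ ≥ kmowDegree a b k Δ β n`.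
[Kothari–Mori–O'Donnell–Witmer 2017, §7 (proof of Thm. 7.1)] [cite: arXiv170104521, Thm. 7.1] -/
theorem kmow_sos_random_kSAT_of_plausible (h : kmow_random_kCNF_plausible) :
    kmow_sos_random_kSAT := by
  obtain ⟨C₀, hC₀, hmain⟩ := h
  refine ⟨3 * C₀, 4 * C₀ + 7, by positivity, by positivity, ?_⟩
  intro k Δ hk hΔ β hβ0 hβ1
  -- parameters
  have hk' : (3 : ℝ) ≤ k := by exact_mod_cast hk
  have hkpos : (0 : ℝ) < k := by linarith
  have hΔ' : (10 : ℝ) ≤ Δ := by exact_mod_cast hΔ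
  have hΔpos : (0 : ℝ) < Δ := by linarith
  set L := Real.log (Δ : ℝ) with hL
  have hL2 : 2 < L := two_lt_log_ten.trans_le (Real.log_le_log (by norm_num) hΔ')
  have hLpos : 0 < L := by linarith
  set ζ := 1 / L with hζ
  have hζpos : 0 < ζ := by positivity
  have hζhalf : ζ < 1 / 2 := by
    rw [hζ, one_div_lt_one_div hLpos (by norm_num)]; exact hL2
  have hζk : ζ ≤ 0.99 * ((k : ℝ) - 2) := by nlinarith
  have hkζ : 0 < (k : ℝ) - 2 - ζ := by linarith
  set β' := β / 2 with hβ'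
  have hβ'0 : 0 < β' := by positivity
  have hβ'1 : β' < 1 / 2 := by rw [hβ']; linarith
  set γ := kmowGamma C₀ k β' with hγ
  have hγpos : 0 < γ := kmowGamma_pos (by omega) hβ'0
  have hγle : γ ≤ 1 / 3 := (kmowGamma_le hC₀.le hk hβ'0 (by linarith)).trans (by
    rw [one_div_le_one_div hkpos (by norm_num)]; exact hk')
  set E := (Δ : ℝ) ^ (2 / ((k : ℝ) - 2 - ζ)) with hE
  have hEpos : 0 < E := Real.rpow_pos_of_pos hΔpos _
  have hE1 : 1 ≤ E := Real.one_le_rpow (by linarith) (by positivity)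
  have hEle : E ≤ Real.exp 4 * (Δ : ℝ) ^ (2 / ((k : ℝ) - 2)) := by
    rw [hE, hζ, hL]; exact rpow_price_le hΔ' hk
  set E₀ := (Δ : ℝ) ^ ((2 : ℝ) / ((k : ℝ) - 2)) with hE₀
  have hE₀pos : 0 < E₀ := Real.rpow_pos_of_pos hΔpos _
  set B := γ / E with hB
  have hBpos : 0 < B := by positivity
  have hBle : B ≤ 1 / 3 := (div_le_self hγpos.le hE1).trans hγle
  -- the degree constant and the key inequality `A ≤ ζ B / 2`
  set A := β ^ (3 * C₀ / k) / ((k : ℝ) * 2 ^ (4 * C₀ + 7)) / (E₀ * L) with hA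
  have hγge := kmowGamma_half_ge hC₀.le hk hβ0 hβ1
  rw [← hβ', ← hγ] at hγge
  have hexp4 := exp_four_lt
  have key : A ≤ ζ * B / 2 := by
    -- `A = β^{3C₀/k} 2^{-4C₀} 2^{-7} / (k E₀ L)` and `ζ B / 2 = γ /(2 E L) ≥ γ/(2 e⁴ E₀ L)`
    have h27 : (2 : ℝ) ^ (4 * C₀ + 7) = 2 ^ (4 * C₀) * 2 ^ (7 : ℝ) := by
      rw [← Real.rpow_add (by norm_num)]
    have h4 : (2 : ℝ) ^ (-(4 * C₀)) = 1 / 2 ^ (4 * C₀) := by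
      rw [Real.rpow_neg (by norm_num), one_div]
    rw [h4] at hγge
    have h2pos : (0 : ℝ) < 2 ^ (4 * C₀) := by positivity
    have h128 : (2 : ℝ) ^ (7 : ℝ) = 128 := by norm_num
    -- lower bound for ζ B / 2
    have hB' : γ / (Real.exp 4 * E₀) ≤ B := by
      rw [hB]; exact div_le_div_of_nonneg_left hγpos.le hEpos hEle
    have hstep : A ≤ ζ * (γ / (Real.exp 4 * E₀)) / 2 := by
      rw [hA, hζ, h27, h128]
      -- everything is explicit now
      rw [show (1 : ℝ) / L * (γ / (Real.exp 4 * E₀)) / 2 = γ / (2 * Real.exp 4 * E₀ * L) by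
        field_simp]
      rw [div_div, div_le_div_iff₀ (by positivity) (by positivity)]
      -- β^{3C₀/k} (2 e⁴ E₀ L) ≤ γ (k 2^{4C₀} 128) (E₀ L)
      have hexp : Real.exp 4 ≤ 64 := hexp4.le
      have hpos1 : 0 ≤ β ^ (3 * C₀ / ↑k) := by positivity
      calc β ^ (3 * C₀ / ↑k) * (2 * Real.exp 4 * E₀ * L)
          ≤ β ^ (3 * C₀ / ↑k) * (2 * 64 * E₀ * L) := by gcongr
        _ = (1 / (k : ℝ) * (β ^ (3 * C₀ / ↑k) * (1 / 2 ^ (4 * C₀)))) *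
              ((k : ℝ) * (2 ^ (4 * C₀) * 128) * (E₀ * L)) := by
            field_simp
            ring
        _ ≤ γ * ((k : ℝ) * (2 ^ (4 * C₀) * 128) * (E₀ * L)) := by gcongr
    calc A ≤ ζ * (γ / (Real.exp 4 * E₀)) / 2 := hstep
      _ ≤ ζ * B / 2 := by gcongr
  -- eventually in `n`
  rw [Filter.eventually_atTop]
  refine ⟨⌈((k : ℝ) / ζ + 2) / B⌉₊, fun n hn => ?_⟩
  have hn' : ((k : ℝ) / ζ + 2) / B ≤ n := (Nat.le_ceil _).trans (by exact_mod_cast hn)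
  have hBn : (k : ℝ) / ζ + 2 ≤ B * n := by
    rw [div_le_iff₀ hBpos] at hn'; linarith
  have hkζ' : 0 < (k : ℝ) / ζ := by positivity
  set nₛ := ⌊B * n⌋₊ with hns
  have hns_le : (nₛ : ℝ) ≤ B * n := Nat.floor_le (by positivity)
  have hns_ge : B * n - 1 ≤ nₛ := by
    have := Nat.lt_floor_add_one (B * n)
    rw [hns]; linarith
  have h1ns : 1 ≤ nₛ := by
    have : (1 : ℝ) ≤ nₛ := by linarith
    exact_mod_cast this
  have h2ns : 2 * (nₛ : ℝ) ≤ n := by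
    have : B * n ≤ n / 3 := by
      rw [show (n : ℝ) / 3 = 1 / 3 * n by ring]
      exact mul_le_mul_of_nonneg_right hBle (Nat.cast_nonneg n)
    linarith
  have hkns : (k : ℝ) ≤ ζ * nₛ := by
    have h1 : ζ * (B * n - 1) ≤ ζ * nₛ := mul_le_mul_of_nonneg_left hns_ge hζpos.le
    have h2 : ζ * ((k : ℝ) / ζ + 1) ≤ ζ * (B * n - 1) :=
      mul_le_mul_of_nonneg_left (by linarith) hζpos.le
    have h3 : ζ * ((k : ℝ) / ζ + 1) = k + ζ := by field_simp
    linarith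
  have hns_bound : (nₛ : ℝ) ≤ kmowGamma C₀ k β' * n / (Δ : ℝ) ^ (2 / ((k : ℝ) - 2 - ζ)) := by
    rw [← hγ, ← hE]
    calc (nₛ : ℝ) ≤ B * n := hns_le
      _ = γ * n / E := by rw [hB]; ring
  have hprob := hmain k Δ hk ζ β' hζpos hζk hβ'0 hβ'1 n nₛ h1ns h2ns hkns hns_bound
  -- degree comparison
  set D := kmowDegree (3 * C₀) (4 * C₀ + 7) k Δ β n with hD
  have hDle : D ≤ ⌊ζ * nₛ⌋₊ := by
    rw [hD, kmowDegree]
    apply Nat.floor_le_floor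
    rw [← hL, ← hE₀]
    calc β ^ (3 * C₀ / ↑k) / (↑k * 2 ^ (4 * C₀ + 7)) * ↑n / (E₀ * L) = A * n := by
          rw [hA]; ring
      _ ≤ ζ * B / 2 * n := by gcongr
      _ ≤ ζ * (B * n - 1) := by nlinarith
      _ ≤ ζ * nₛ := mul_le_mul_of_nonneg_left hns_ge hζpos.le
  -- event inclusion on the support of the ensemble
  have hsub : {φ : CNF ℕ | IsCoverExpander (cnfScopes φ) (2 * nₛ) (((k : ℝ) + ζ) / 2)} ∩
      (randomKCNF k n (Δ * n)).support ⊆ {φ | SOSFailsToRefute D φ} := by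
    rintro φ ⟨hcov, hsupp⟩
    have hall := forall_mem_of_mem_support_randomKCNF hsupp
    have hnd : ∀ C ∈ φ, (C.map Prod.fst).Nodup := fun C hC =>
      nodup_map_fst_of_mem_kClauses (hall C hC)
    have hcard : ∀ i, (cnfScopes φ i).card ≤ k := fun i =>
      (card_clauseScope_of_mem_kClauses (hall _ (List.getElem_mem ..))).le
    have hbexp : IsBoundaryExpander (cnfScopes φ) (2 * nₛ) ζ := hcov.isBoundaryExpander hcard
    have hr : (2 : ℝ) ≤ 2 * nₛ := by
      have : (1 : ℝ) ≤ nₛ := by exact_mod_cast h1ns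
      linarith
    have hd : ((⌊ζ * nₛ⌋₊ : ℕ) : ℝ) ≤ ζ * (2 * nₛ) / 2 := by
      rw [show ζ * (2 * (nₛ : ℝ)) / 2 = ζ * nₛ by ring]
      exact Nat.floor_le (by positivity)
    exact (sosFailsToRefute_of_isBoundaryExpander φ hnd hbexp hζpos hr hd).of_le hDle
  -- probabilities
  calc 1 - ENNReal.ofReal β ≤ 1 - ENNReal.ofReal β' :=
        tsub_le_tsub_left (ENNReal.ofReal_le_ofReal (by rw [hβ']; linarith)) 1
    _ ≤ (randomKCNF k n (Δ * n)).toOuterMeasure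
          {φ | IsCoverExpander (cnfScopes φ) (2 * nₛ) (((k : ℝ) + ζ) / 2)} := hprob
    _ = (randomKCNF k n (Δ * n)).toOuterMeasure
          ({φ | IsCoverExpander (cnfScopes φ) (2 * nₛ) (((k : ℝ) + ζ) / 2)} ∩
            (randomKCNF k n (Δ * n)).support) :=
        (PMF.toOuterMeasure_apply_inter_support _ _).symm
    _ ≤ (randomKCNF k n (Δ * n)).toOuterMeasure {φ | SOSFailsToRefute D φ} :=
        (randomKCNF k n (Δ * n)).toOuterMeasure.mono hsub

/-- **DISCHARGE of `kmow_sos_random_kSAT`** (Kothari–Mori–O'Donnell–Witmer 2017, Thm. 7.1 for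
`k`-SAT): unconditional, from the proved random-graph theorem `kmow_random_kCNF_plausible_holds`
(KMOW Thm. 4.12, `ScopeExpansionProofs.lean`) and the proved Grigoriev–Schoenebeck theorem via
`kmow_sos_random_kSAT_of_plausible`. [Kothari–Mori–O'Donnell–Witmer 2017, Thm. 7.1]
[cite: arXiv170104521, Thm. 7.1] -/
theorem kmow_sos_random_kSAT_holds : kmow_sos_random_kSAT :=
  kmow_sos_random_kSAT_of_plausible kmow_random_kCNF_plausible_holds

end Literature.Computability.MetaComplexity
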